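import Summits.ValiantsHypothesis.ValiantsHypothesis.Theorems.BarrierLeverAnchoredDoorHitsLowerPairsDecrementHereditary
import Summits.ValiantsHypothesis.ValiantsHypothesis.Theorems.BarrierLeverAnchoredDoorHitsLowerPairsReenum

/-!
# Support item `AnchoredDoorHitsLowerPairs` (stmt-ValiantsHypothesis-22510), line `anchored-peeling`:
# EMBEDDING INVARIANCE of the symbolic anchored minor (padding the ambient `Fin h`), and INSTANCE LIFTING

Helper file (`--supports stmt-ValiantsHypothesis-22510`; cell valiant-natproofs, rung V4, 𝒟-side door (c); registered line
`Cruxes/AnchoredDoorHitsLowerPairs/Lines/anchored_peeling.lean` v21/v22; prover seat val-np-p1 gen 23; companion of `…Relabel` (p654443, permutations of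
`Fin h`) and `…Reenum` (p597047-era, re-enumeration invariance)). Five bookkeeping `def`s (`killVars`, `embVars`, `anchorEmb`, `paramEmb`, `imVars`).
Closes NO item.

WHY. The line's certificate engine lands kernel INSTANCES at a fixed ambient size (`Dec2/Dec3/Dec4`, `R3K7`, `R4K15`, `C6m1K11`, `Split1/Split2`:
`symbolicDet 1 h₀ r u₀ w₀ ≠ 0` by `decide`), while the registered statements quantify over every `h ≥ h₀`, every enumeration and (after p654443) every
relabelling. This file closes the remaining gap: along ANY injection `ι : Fin h ↪ Fin h'` of the coordinates,
`symbolicDet s h' r (ι ∘ u) (ι ∘ w) = rename (paramEmb ι) (symbolicDet s h r u w)` (`symbolicDet_emb`), so non-vanishing is invariant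
(`symbolicDet_ne_zero_emb_iff`). PROOF: kill every variable outside the image of `ι` (`killVars`, the substitution `X_v ↦ 0` off the image —
the `BlockGlue.kill` of `…BlockProduct` over a general coefficient ring): anchor factors of `𝔄_s(h')` not coming from `h` die to `1`, image factors
become the renamed factors of `𝔄_s(h)` (`kill_symbFactor_emb`, `kill_symbFactor_eq_one`), and coefficients of image monomials are unchanged by the
killing (`coeff_killVars`). CONSEQUENCE (`symbolicDet_ne_zero_lift`): an instance at `(h₀, u₀, w₀)` gives non-vanishing for EVERY `h`, every injection
`ι : Fin h₀ ↪ Fin h` and every pair of injective enumerations whose ranges are the `ι`-images of the instance's ranges (with `…Reenum`).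

WHAT THIS IS NOT: bookkeeping; nothing on crux stmt-ValiantsHypothesis-14610 or on `VP` versus `VNP`.
-/

set_option linter.dupNamespace false

namespace Summit.ValiantsHypothesis.ValiantsHypothesis.Theorems.BarrierLever.AnchoredPeeling

open Finset MvPolynomial
open Summit.ValiantsHypothesis.ValiantsHypothesis.Theorems.BarrierLever.BrickCalculus (pexpo pexpo_def pexpo_apply_castAdd pexpo_apply_natAdd)

noncomputable section

/-! ## 1. Killing the variables outside a set (general coefficients) -/

section Kill

variable {σ R : Type*} [DecidableEq σ] [CommSemiring R]

/-- The substitution killing every variable outside `V` (general coefficient ring; cf. `BlockGlue.kill`). -/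
def killVars (V : Finset σ) : MvPolynomial σ R →ₐ[R] MvPolynomial σ R :=
  bind₁ fun v => if v ∈ V then X v else 0

/-- `killVars` on a variable. -/
theorem killVars_X (V : Finset σ) (v : σ) : killVars V (X v : MvPolynomial σ R) = if v ∈ V then X v else 0 := by
  rw [killVars, bind₁_X_right]

/-- `killVars` on a constant. -/
theorem killVars_C (V : Finset σ) (r : R) : killVars V (C r : MvPolynomial σ R) = C r := by
  rw [killVars, bind₁_C_right]

/-- `killVars` on a monomial: kept iff supported inside `V`. -/
theorem killVars_monomial (V : Finset σ) (d : σ →₀ ℕ) (r : R) :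
    killVars V (monomial d r) = if d.support ⊆ V then monomial d r else 0 := by
  rw [killVars, bind₁_monomial]
  by_cases hd : d.support ⊆ V
  · rw [if_pos hd, monomial_eq, Finsupp.prod]
    congr 1
    exact Finset.prod_congr rfl (fun i hi => by rw [if_pos (hd hi)])
  · rw [if_neg hd]
    obtain ⟨i, hi, hiV⟩ := Finset.not_subset.mp hd
    rw [Finset.prod_eq_zero hi, mul_zero]
    rw [if_neg hiV, zero_pow (Finsupp.mem_support_iff.mp hi)]

/-- Coefficients after killing: monomials inside `V` keep their coefficient, the others vanish. -/
theorem coeff_killVars (V : Finset σ) (f : MvPolynomial σ R) (m : σ →₀ ℕ) :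
    coeff m (killVars V f) = if m.support ⊆ V then coeff m f else 0 := by
  conv_lhs => rw [f.as_sum, map_sum, coeff_sum]
  simp_rw [killVars_monomial]
  have hterm : ∀ d ∈ f.support, coeff m (if d.support ⊆ V then monomial d (coeff d f) else 0) =
      if d = m then (if m.support ⊆ V then coeff m f else 0) else 0 := by
    intro d _
    by_cases hdm : d = m
    · subst hdm
      by_cases hV : d.support ⊆ V
      · rw [if_pos hV, if_pos rfl, if_pos hV, coeff_monomial, if_pos rfl]
      · rw [if_neg hV, if_pos rfl, if_neg hV, coeff_zero]
    · rw [if_neg hdm]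
      by_cases hV : d.support ⊆ V
      · rw [if_pos hV, coeff_monomial, if_neg hdm]
      · rw [if_neg hV, coeff_zero]
  rw [Finset.sum_congr rfl hterm, Finset.sum_ite_eq' f.support m]
  by_cases hm : m ∈ f.support
  · rw [if_pos hm]
  · rw [if_neg hm]
    by_cases hV : m.support ⊆ V
    · rw [if_pos hV, notMem_support_iff.mp hm]
    · rw [if_neg hV]

end Kill

variable {h h' : ℕ}

/-! ## 2. The embedding maps -/

/-- The embedding of the variables along `ι`: `x_a ↦ x_{ι a}`, `y_c ↦ y_{ι c}`. -/
def embVars (ι : Fin h ↪ Fin h') : Fin (h + h) → Fin (h' + h') :=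
  fun v => finSumFinEquiv (Sum.map ι ι (finSumFinEquiv.symm v))

/-- `embVars` on an `x`-variable. -/
theorem embVars_castAdd (ι : Fin h ↪ Fin h') (a : Fin h) : embVars ι (Fin.castAdd h a) = Fin.castAdd h' (ι a) := by
  simp only [embVars, finSumFinEquiv_symm_apply_castAdd, Sum.map_inl, finSumFinEquiv_apply_left]

/-- `embVars` on a `y`-variable. -/
theorem embVars_natAdd (ι : Fin h ↪ Fin h') (c : Fin h) : embVars ι (Fin.natAdd h c) = Fin.natAdd h' (ι c) := by
  simp only [embVars, finSumFinEquiv_symm_apply_natAdd, Sum.map_inr, finSumFinEquiv_apply_right]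

/-- `embVars` is injective. -/
theorem embVars_injective (ι : Fin h ↪ Fin h') : Function.Injective (embVars ι) :=
  finSumFinEquiv.injective.comp ((Sum.map_injective.mpr ⟨ι.injective, ι.injective⟩).comp finSumFinEquiv.symm.injective)

/-- The embedding of an anchor `(A | B) ↦ (ι A | ι B)`. -/
def anchorEmb (ι : Fin h ↪ Fin h') (α : Finset (Fin h) × Finset (Fin h)) : Finset (Fin h') × Finset (Fin h') :=
  (α.1.map ι, α.2.map ι)

/-- `anchorEmb` is injective. -/
theorem anchorEmb_injective (ι : Fin h ↪ Fin h') : Function.Injective (anchorEmb ι) := by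
  intro α β hαβ
  simp only [anchorEmb, Prod.mk.injEq] at hαβ
  exact Prod.ext (Finset.map_injective ι hαβ.1) (Finset.map_injective ι hαβ.2)

/-- The embedding of the parameters: `θ_(A|B) ↦ θ_(ιA|ιB)`, `φ_{(A|B), b} ↦ φ_{(ιA|ιB), ι b}`, `ψ_{(A|B), d} ↦ ψ_{(ιA|ιB), ι d}`. -/
def paramEmb (ι : Fin h ↪ Fin h') : Param h → Param h'
  | Sum.inl α => Sum.inl (anchorEmb ι α)
  | Sum.inr (Sum.inl (α, b)) => Sum.inr (Sum.inl (anchorEmb ι α, ι b))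
  | Sum.inr (Sum.inr (α, d)) => Sum.inr (Sum.inr (anchorEmb ι α, ι d))

/-- `paramEmb` is injective. -/
theorem paramEmb_injective (ι : Fin h ↪ Fin h') : Function.Injective (paramEmb ι) := by
  intro p q hpq
  rcases p with α | ⟨α, b⟩ | ⟨α, d⟩ <;> rcases q with β | ⟨β, b'⟩ | ⟨β, d'⟩ <;>
    simp only [paramEmb, Sum.inl.injEq, Sum.inr.injEq, Prod.mk.injEq, reduceCtorEq] at hpq
  · rw [anchorEmb_injective ι hpq]
  · rw [anchorEmb_injective ι hpq.1, ι.injective hpq.2]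
  · rw [anchorEmb_injective ι hpq.1, ι.injective hpq.2]

/-- The embedding maps the partition exponent of `(U, W)` to that of `(ι U, ι W)`. -/
theorem mapDomain_embVars (ι : Fin h ↪ Fin h') (U W : Finset (Fin h)) :
    Finsupp.mapDomain (embVars ι) (pexpo U W) = pexpo (U.map ι) (W.map ι) := by
  rw [pexpo_def, pexpo_def, Finsupp.mapDomain_add, Finsupp.mapDomain_finsetSum, Finsupp.mapDomain_finsetSum,
    Finset.sum_map, Finset.sum_map]
  congr 1
  · refine Finset.sum_congr rfl fun a _ => ?_
    rw [Finsupp.mapDomain_single, embVars_castAdd]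
  · refine Finset.sum_congr rfl fun c _ => ?_
    rw [Finsupp.mapDomain_single, embVars_natAdd]

/-- The image variables of `ι`. -/
def imVars (ι : Fin h ↪ Fin h') : Finset (Fin (h' + h')) :=
  (Finset.univ.map ι).map (Fin.castAddEmb h') ∪ (Finset.univ.map ι).map (Fin.natAddEmb h')

/-- An `x`-variable is an image variable iff its index is in the range of `ι`. -/
theorem castAdd_mem_imVars (ι : Fin h ↪ Fin h') (a' : Fin h') : Fin.castAdd h' a' ∈ imVars ι ↔ a' ∈ Set.range ι := by
  rw [imVars, Finset.mem_union]
  constructor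
  · rintro (hx | hx)
    · obtain ⟨b, hb, hba⟩ := Finset.mem_map.mp hx
      obtain ⟨a, _, rfl⟩ := Finset.mem_map.mp hb
      have : ι a = a' := by have := Fin.ext_iff.mp hba; simp only [Fin.castAddEmb_apply, Fin.val_castAdd] at this; exact Fin.ext this
      exact ⟨a, this⟩
    · obtain ⟨b, _, hba⟩ := Finset.mem_map.mp hx
      have := Fin.ext_iff.mp hba; simp only [Fin.natAddEmb_apply, Fin.val_natAdd, Fin.val_castAdd] at this
      have := b.isLt; omega
  · rintro ⟨a, rfl⟩
    exact Or.inl (Finset.mem_map.mpr ⟨ι a, Finset.mem_map.mpr ⟨a, Finset.mem_univ a, rfl⟩, rfl⟩)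

/-- A `y`-variable is an image variable iff its index is in the range of `ι`. -/
theorem natAdd_mem_imVars (ι : Fin h ↪ Fin h') (c' : Fin h') : Fin.natAdd h' c' ∈ imVars ι ↔ c' ∈ Set.range ι := by
  rw [imVars, Finset.mem_union]
  constructor
  · rintro (hx | hx)
    · obtain ⟨b, _, hba⟩ := Finset.mem_map.mp hx
      have := Fin.ext_iff.mp hba; simp only [Fin.castAddEmb_apply, Fin.val_natAdd, Fin.val_castAdd] at this
      have := b.isLt; omega
    · obtain ⟨b, hb, hba⟩ := Finset.mem_map.mp hx
      obtain ⟨c, _, rfl⟩ := Finset.mem_map.mp hb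
      have : ι c = c' := by have := Fin.ext_iff.mp hba; simp only [Fin.natAddEmb_apply, Fin.val_natAdd] at this; exact Fin.ext (by omega)
      exact ⟨c, this⟩
  · rintro ⟨c, rfl⟩
    exact Or.inr (Finset.mem_map.mpr ⟨ι c, Finset.mem_map.mpr ⟨c, Finset.mem_univ c, rfl⟩, rfl⟩)

/-! ## 3. Killing the outside variables in the big witness -/

/-- The big anchor factor of an embedded anchor, killed outside the image, is the renamed small factor. -/
theorem kill_symbFactor_emb (ι : Fin h ↪ Fin h') (α : Finset (Fin h) × Finset (Fin h)) :
    killVars (imVars ι) (symbFactor h' (anchorEmb ι α)) =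
      MvPolynomial.map (rename (paramEmb ι)).toRingHom (rename (embVars ι) (symbFactor h α)) := by
  classical
  -- the complements of the image sets: image part and outside part
  have hsplit : ∀ (A : Finset (Fin h)),
      (univ \ A.map ι) = (univ \ A).map ι ∪ (univ \ A.map ι).filter (fun b' => b' ∉ Set.range ι) := by
    intro A; ext b'
    simp only [Finset.mem_sdiff, Finset.mem_univ, true_and, Finset.mem_union, Finset.mem_map, Finset.mem_filter, Set.mem_range]
    constructor
    · intro hb
      by_cases hr : ∃ a, ι a = b'
      · obtain ⟨a, rfl⟩ := hr
        exact Or.inl ⟨a, fun ha => hb ⟨a, ha, rfl⟩, rfl⟩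
      · exact Or.inr ⟨hb, hr⟩
    · rintro (⟨a, ha, rfl⟩ | ⟨hb, _⟩)
      · rintro ⟨a', ha', he⟩; rw [ι.injective he] at ha'; exact ha ha'
      · exact hb
  have hdisj : ∀ (A : Finset (Fin h)), Disjoint ((univ \ A).map ι) ((univ \ A.map ι).filter (fun b' => b' ∉ Set.range ι)) := by
    intro A; rw [Finset.disjoint_left]
    rintro b' h1 h2
    obtain ⟨a, _, rfl⟩ := Finset.mem_map.mp h1
    exact (Finset.mem_filter.mp h2).2 ⟨a, rfl⟩
  -- the outside tail factors are killed to 1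
  have hkx : ∀ (A : Finset (Fin h)) (g : Fin h' → MvPolynomial (Param h') ℂ),
      ∏ b' ∈ (univ \ A.map ι).filter (fun b' => b' ∉ Set.range ι), killVars (imVars ι) (1 + C (g b') * X (Fin.castAdd h' b')) = 1 := by
    intro A g
    refine Finset.prod_eq_one (fun b' hb' => ?_)
    have hb'r : b' ∉ Set.range ι := (Finset.mem_filter.mp hb').2
    rw [map_add, map_one, map_mul, killVars_C, killVars_X, if_neg (fun hm => hb'r ((castAdd_mem_imVars ι b').mp hm)), mul_zero, add_zero]
  have hky : ∀ (A : Finset (Fin h)) (g : Fin h' → MvPolynomial (Param h') ℂ),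
      ∏ d' ∈ (univ \ A.map ι).filter (fun b' => b' ∉ Set.range ι), killVars (imVars ι) (1 + C (g d') * X (Fin.natAdd h' d')) = 1 := by
    intro A g
    refine Finset.prod_eq_one (fun d' hd' => ?_)
    have hd'r : d' ∉ Set.range ι := (Finset.mem_filter.mp hd').2
    rw [map_add, map_one, map_mul, killVars_C, killVars_X, if_neg (fun hm => hd'r ((natAdd_mem_imVars ι d').mp hm)), mul_zero, add_zero]
  rw [symbFactor, symbFactor]
  simp only [anchorEmb]
  rw [map_add, map_one, map_mul, map_mul, map_mul, map_mul, map_prod, map_prod, map_prod, map_prod]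
  rw [hsplit α.1, hsplit α.2, Finset.prod_union (hdisj α.1), Finset.prod_union (hdisj α.2), hkx, hky, mul_one, mul_one,
    Finset.prod_map, Finset.prod_map, Finset.prod_map, Finset.prod_map]
  simp only [map_add, map_one, map_mul, map_prod, rename_C, rename_X, map_C, map_X, AlgHom.toRingHom_eq_coe, RingHom.coe_coe,
    embVars_castAdd, embVars_natAdd, paramEmb, anchorEmb, killVars_C, killVars_X]
  have hxi : ∀ a : Fin h, (if Fin.castAdd h' (ι a) ∈ imVars ι then (X (Fin.castAdd h' (ι a)) : MvPolynomial (Fin (h' + h')) (MvPolynomial (Param h') ℂ))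
      else 0) = X (Fin.castAdd h' (ι a)) := fun a => if_pos ((castAdd_mem_imVars ι _).mpr ⟨a, rfl⟩)
  have hyi : ∀ c : Fin h, (if Fin.natAdd h' (ι c) ∈ imVars ι then (X (Fin.natAdd h' (ι c)) : MvPolynomial (Fin (h' + h')) (MvPolynomial (Param h') ℂ))
      else 0) = X (Fin.natAdd h' (ι c)) := fun c => if_pos ((natAdd_mem_imVars ι _).mpr ⟨c, rfl⟩)
  simp only [hxi, hyi]

/-- A big anchor factor NOT coming from an anchor of `h` is killed to `1` (its head monomial has a variable outside the image). -/
theorem kill_symbFactor_eq_one (ι : Fin h ↪ Fin h') (α' : Finset (Fin h') × Finset (Fin h')) (hα' : α' ∉ Set.range (anchorEmb ι)) :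
    killVars (imVars ι) (symbFactor h' α') = 1 := by
  classical
  -- some vertex of α' is outside the range of ι
  have hout : (∃ a' ∈ α'.1, a' ∉ Set.range ι) ∨ (∃ c' ∈ α'.2, c' ∉ Set.range ι) := by
    by_contra hcon
    have h1 : ∀ a' ∈ α'.1, a' ∈ Set.range ι := fun a' ha' => by by_contra hh; exact hcon (Or.inl ⟨a', ha', hh⟩)
    have h2 : ∀ c' ∈ α'.2, c' ∈ Set.range ι := fun c' hc' => by by_contra hh; exact hcon (Or.inr ⟨c', hc', hh⟩)
    apply hα'
    refine ⟨(Finset.univ.filter (fun a => ι a ∈ α'.1), Finset.univ.filter (fun c => ι c ∈ α'.2)), ?_⟩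
    obtain ⟨A', B'⟩ := α'
    simp only [anchorEmb, Prod.mk.injEq]
    constructor
    · ext b'
      simp only [Finset.mem_map, Finset.mem_filter, Finset.mem_univ, true_and]
      constructor
      · rintro ⟨a, ha, rfl⟩; exact ha
      · intro hb'; obtain ⟨a, rfl⟩ := h1 b' hb'; exact ⟨a, hb', rfl⟩
    · ext d'
      simp only [Finset.mem_map, Finset.mem_filter, Finset.mem_univ, true_and]
      constructor
      · rintro ⟨c, hc, rfl⟩; exact hc
      · intro hd'; obtain ⟨c, rfl⟩ := h2 d' hd'; exact ⟨c, hd', rfl⟩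
  rw [symbFactor, map_add, map_one, map_mul, map_mul, map_mul, map_mul]
  rcases hout with ⟨a', ha', hr⟩ | ⟨c', hc', hr⟩
  · have h0 : killVars (imVars ι) (∏ a ∈ α'.1, (X (Fin.castAdd h' a) : MvPolynomial (Fin (h' + h')) (MvPolynomial (Param h') ℂ))) = 0 := by
      rw [map_prod]
      exact Finset.prod_eq_zero ha' (by rw [killVars_X, if_neg (fun hm => hr ((castAdd_mem_imVars ι a').mp hm))])
    rw [h0]; ring
  · have h0 : killVars (imVars ι) (∏ c ∈ α'.2, (X (Fin.natAdd h' c) : MvPolynomial (Fin (h' + h')) (MvPolynomial (Param h') ℂ))) = 0 := by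
      rw [map_prod]
      exact Finset.prod_eq_zero hc' (by rw [killVars_X, if_neg (fun hm => hr ((natAdd_mem_imVars ι c').mp hm))])
    rw [h0]; ring

/-- Embedded anchors are anchors (cardinalities are preserved). -/
theorem anchorEmb_mem_anchors_iff (ι : Fin h ↪ Fin h') (s : ℕ) (α : Finset (Fin h) × Finset (Fin h)) :
    α ∈ anchors s h ↔ anchorEmb ι α ∈ anchors s h' := by
  simp only [anchors, Finset.mem_filter, Finset.mem_univ, true_and, anchorEmb, Finset.card_map]

/-- **Killing the outside variables maps the big symbolic witness to the renamed small one.** -/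
theorem kill_symbolicWitness_emb (ι : Fin h ↪ Fin h') (s : ℕ) :
    killVars (imVars ι) (symbolicWitness s h') = MvPolynomial.map (rename (paramEmb ι)).toRingHom (rename (embVars ι) (symbolicWitness s h)) := by
  classical
  rw [symbolicWitness_eq_prod, symbolicWitness_eq_prod, map_prod, map_prod, map_prod]
  have hsub : (anchors s h).map ⟨anchorEmb ι, anchorEmb_injective ι⟩ ⊆ anchors s h' := by
    intro α' hα'
    obtain ⟨α, hα, rfl⟩ := Finset.mem_map.mp hα'
    exact (anchorEmb_mem_anchors_iff ι s α).mp hα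
  rw [show (∏ α ∈ anchors s h, MvPolynomial.map (rename (paramEmb ι)).toRingHom (rename (embVars ι) (symbFactor h α))) =
      ∏ α' ∈ (anchors s h).map ⟨anchorEmb ι, anchorEmb_injective ι⟩, killVars (imVars ι) (symbFactor h' α') from by
    rw [Finset.prod_map]; exact Finset.prod_congr rfl (fun α _ => (kill_symbFactor_emb ι α).symm)]
  symm
  apply Finset.prod_subset hsub
  intro α' hα' hnot
  apply kill_symbFactor_eq_one
  rintro ⟨α, rfl⟩
  exact hnot (Finset.mem_map.mpr ⟨α, (anchorEmb_mem_anchors_iff ι s α).mpr hα', rfl⟩)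

/-- Entries of the embedded layout are the renamed entries. -/
theorem coeff_symbolicWitness_emb (ι : Fin h ↪ Fin h') (s : ℕ) (U W : Finset (Fin h)) :
    coeff (pexpo (U.map ι) (W.map ι)) (symbolicWitness s h') = rename (paramEmb ι) (coeff (pexpo U W) (symbolicWitness s h)) := by
  classical
  have hsupp : (pexpo (U.map ι) (W.map ι)).support ⊆ imVars ι := by
    intro v hv
    rw [Finsupp.mem_support_iff] at hv
    induction v using Fin.addCases with
    | left a' =>
      rw [pexpo_apply_castAdd] at hv
      have ha' : a' ∈ U.map ι := by by_contra hh; exact hv (if_neg hh)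
      obtain ⟨a, _, rfl⟩ := Finset.mem_map.mp ha'
      exact (castAdd_mem_imVars ι _).mpr ⟨a, rfl⟩
    | right c' =>
      rw [pexpo_apply_natAdd] at hv
      have hc' : c' ∈ W.map ι := by by_contra hh; exact hv (if_neg hh)
      obtain ⟨c, _, rfl⟩ := Finset.mem_map.mp hc'
      exact (natAdd_mem_imVars ι _).mpr ⟨c, rfl⟩
  have h1 : coeff (pexpo (U.map ι) (W.map ι)) (symbolicWitness s h') = coeff (pexpo (U.map ι) (W.map ι)) (killVars (imVars ι) (symbolicWitness s h')) := by
    rw [coeff_killVars, if_pos hsupp]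
  rw [h1, kill_symbolicWitness_emb, coeff_map, AlgHom.toRingHom_eq_coe, RingHom.coe_coe, ← mapDomain_embVars,
    coeff_rename_mapDomain _ (embVars_injective ι)]

/-! ## 4. The symbolic minor under an embedding; instance lifting -/

/-- **Embedding formula:** the symbolic minor of the embedded layout `(ι ∘ u, ι ∘ w)` is the renamed symbolic minor of `(u, w)`. -/
theorem symbolicDet_emb (ι : Fin h ↪ Fin h') (s r : ℕ) (u w : Fin r → Finset (Fin h)) :
    symbolicDet s h' r (fun i => (u i).map ι) (fun j => (w j).map ι) = rename (paramEmb ι) (symbolicDet s h r u w) := by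
  have h1 : symbolicDet s h r u w = (Matrix.of fun i j : Fin r => coeff (pexpo (u i) (w j)) (symbolicWitness s h)).det := rfl
  have h2 : symbolicDet s h' r (fun i => (u i).map ι) (fun j => (w j).map ι) =
      (Matrix.of fun i j : Fin r => coeff (pexpo ((u i).map ι) ((w j).map ι)) (symbolicWitness s h')).det := rfl
  rw [h1, h2, AlgHom.map_det]
  congr 1
  ext i j
  rw [AlgHom.mapMatrix_apply, Matrix.map_apply, Matrix.of_apply, Matrix.of_apply, coeff_symbolicWitness_emb]

/-- **Non-vanishing of the symbolic minor is invariant under embeddings of the coordinates.** -/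
theorem symbolicDet_ne_zero_emb_iff (ι : Fin h ↪ Fin h') (s r : ℕ) (u w : Fin r → Finset (Fin h)) :
    symbolicDet s h' r (fun i => (u i).map ι) (fun j => (w j).map ι) ≠ 0 ↔ symbolicDet s h r u w ≠ 0 := by
  rw [symbolicDet_emb]
  constructor
  · intro hne h0; exact hne (by rw [h0, map_zero])
  · intro hne h0; exact hne (rename_injective _ (paramEmb_injective ι) (by rw [h0, map_zero]))

/-- **INSTANCE LIFTING.** A non-vanishing instance `(u₀, w₀)` at ambient size `h` gives non-vanishing at every ambient size `h'`, along every
injection `ι : Fin h ↪ Fin h'`, for every pair of injective enumerations whose ranges are the `ι`-images of the instance's ranges. -/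
theorem symbolicDet_ne_zero_lift {s r r' : ℕ} (ι : Fin h ↪ Fin h') (u₀ w₀ : Fin r → Finset (Fin h)) (hu₀ : Function.Injective u₀)
    (hw₀ : Function.Injective w₀) (hinst : symbolicDet s h r u₀ w₀ ≠ 0) (u w : Fin r' → Finset (Fin h'))
    (hu : Function.Injective u) (hw : Function.Injective w)
    (hru : Set.range u = Set.range (fun i => (u₀ i).map ι)) (hrw : Set.range w = Set.range (fun j => (w₀ j).map ι)) :
    symbolicDet s h' r' u w ≠ 0 :=
  symbolicDet_ne_zero_of_range_eq _ _ u w (fun _ _ hii => hu₀ (Finset.map_injective ι hii)) (fun _ _ hjj => hw₀ (Finset.map_injective ι hjj))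
    hu hw hru hrw ((symbolicDet_ne_zero_emb_iff ι s r u₀ w₀).mpr hinst)

end

end Summit.ValiantsHypothesis.ValiantsHypothesis.Theorems.BarrierLever.AnchoredPeeling
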